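import Summits.HodgeConjecture.HodgeConjecture.Theorems.VHCAbelianSchemesRoadSecantQuotientAnchorPinnedCompatible
import Literature.AlgebraicGeometry.HodgeTheory.WeilClassesFourfolds
import Literature.AlgebraicGeometry.HodgeTheory.HodgeRiemannDegreeOne
import HarnessLib

/-!
# Road b02 (`VHCAbelianSchemesRoad`, D-0059) — lane W1, (G3) entrance at CLASS level: at a COMPATIBLE Weil anchor the Lefschetz ray `ℂ·h³` MISSES
# the Weil plane, so the off-ray clause of the pinned secant–quotient predicate is just `γ ≠ 0`, and `φ_d^*` fixes every served direction

research route conditional on HC_CM; not a corollary; Q11.4-sentence-2 already refuted in dim ≥ 3.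

THEOREMS ONLY (fact-free, no definition, `HC_CM` nowhere; nothing of an existing file is edited). ring2-b03x gen 3, after R2 (p562853
`…SecantQuotientAnchorPinnedCompatible`), director-hodge g10 R10.4 (4) «W1 → (G3) after R2»: (G3) = at ONE pinned anchor `(X, θ)`, one carried rational
pinned-served direction should carry EVERY rational pinned-served direction (`SecantQuotientWeilDirectionTransfer63.sameAnchor`, p556635; named as
`SecantQuotientSameAnchorTransfer63` in the companion definitions file). This file pins down the DOMAIN of (G3) at class level, using only the tree's
`map_eq_smul_of_mem_weilClassesOf` («`φ^*` acts on the Weil plane `E₊ ⊔ E₋ ⊆ H²ⁿ` as the scalar `(-d)ⁿ`», `WeilClassesFourfolds`) and R2's compatibility: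

* §1 TOOLBOX (any abelian variety `A`, `φ : A ⟶ A`, `d > 0`, `n` ODD, a class `h ∈ H²` with `φ^*h = d·h`): `φ^*hⁿ = dⁿ·hⁿ`
  (`map_cupPowTwo_eq_pow_smul_of_map_eq_smul`) while `φ^* = (-d)ⁿ = -dⁿ` on `weilClassesOf A φ n d`, so **`ℂ·hⁿ ⊓ weilClassesOf A φ n d = ⊥`**
  (`span_cupPowTwo_inf_weilClassesOf_eq_bot`; `2dⁿ ≠ 0` in `ℂ`). For EVEN `n` the two scalars agree and nothing is claimed.
* §2 AT A SECANT–QUOTIENT DATUM (`n = 3`, `(A, φ, h) = (J × Ĵ, φ_d, q^*h_Y(θ₀))`, compatibility = R2's `SecantQuotientDatum.complexBetti_map_ψ_map_q_hY`):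
  a class `γ` on `Y` with `q^*γ` in the Weil plane and `γ ∈ ℂ·h_Y(θ₀)³` is ZERO (`q^*` injective); hence **`γ ≠ 0 ⟹ γ ∉ ℂ·h_Y(θ₀)³`** — the off-ray clause
  of `IsSecantQuotientWeilClassAtPinned` is AUTOMATIC for non-zero classes (`IsSecantQuotientWeilClassAtPinned.of_refl_of_ne_zero`), i.e. the rational
  pinned-served directions at the identity chart of a datum are exactly the non-zero rational points of the descended Weil plane `(q^*)⁻¹(E₊ ⊕ E₋)`: the
  `P¹(ℚ)`-worth (G3) quantifies over; and **`φ_d^*(q^*γ) = -d³·q^*γ`** for every such `γ` — `φ_d^*` (equivalently the descended `ψ_Y^*`) moves NO served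
  direction, the kernel form of refute-markman g2's remark that the «`ψ_Y^*` device serves the same direction» (card rev 4).

Nothing here says (G3), the node, any stub ∕ cell ∕ rung ∕ crux, `Supply″`, VHC, `HC_AV`, `HC_CM` or HC holds.
References: [cite: Markman2025SecantWeil, Thm. 1.4.1 (item 4), §3.2 Cor. 3.2.3 and Lemma 3.1.3] [cite: Markman2025SurveySecant, §1.1]
[cite: vanGeemen1994HodgeAV, 4.9, Lemma 5.2 and Thm. 4.11] [cite: Deligne1982HodgeCycles, §4 (4.3)–Prop. 4.4] [cite: HatcherAT2002, §3.2].
-/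

noncomputable section

open CategoryTheory CategoryTheory.Limits AlgebraicGeometry Topology

namespace Summit.HodgeConjecture.HodgeConjecture.Ring2.SemiregularRepresentatives

set_option linter.dupNamespace false -- the cell's namespace repeats the summit name, as in every `Ring2*` file

open Literature.AlgebraicGeometry Literature.AlgebraicGeometry.Motives Literature.AlgebraicGeometry.Motives.AbelianVariety
open Literature.AlgebraicGeometry.HodgeTheory Literature.AlgebraicGeometry.Markman2025
open Literature.AlgebraicTopology.SingularHomology

/-! ## §1 Toolbox: under compatibility the Lefschetz ray misses the Weil plane (odd `n`) -/

section Toolbox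

variable {A : AbelianVariety ℂ} {φ : A ⟶ A} {n d : ℕ}

/-- **`φ^*h = t·h ⟹ φ^*(hⁿ) = tⁿ·hⁿ`** (pull-back is a ring map: `map_cupPowTwo`; `(t·h)ⁿ = tⁿ·hⁿ`: `cupPowTwo_smul`). [cite: HatcherAT2002, §3.2] -/
theorem map_cupPowTwo_eq_pow_smul_of_map_eq_smul (φ : A ⟶ A) {h : complexBetti A.X 2} {t : ℂ}
    (hφh : complexBetti.map φ.hom.hom.hom 2 h = t • h) (n : ℕ) :
    complexBetti.map φ.hom.hom.hom (2 * n) (cupPowTwo h n) = (t ^ n) • cupPowTwo h n := by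
  change singularCohomology.map ℂ ℂ _ (2 * n) (cupPowTwo h n) = _
  rw [map_cupPowTwo]
  change cupPowTwo (complexBetti.map φ.hom.hom.hom 2 h) n = _
  rw [hφh, cupPowTwo_smul]

/-- **A class on the ray `ℂ·hⁿ` AND in the Weil plane is zero**, for `n` odd, `d > 0` and `h` COMPATIBLE with `φ` (`φ^*h = d·h`, van Geemen's
`E(kx, ky) = Nm(k)E(x, y)`): `φ^*` scales the ray by `dⁿ` and the Weil plane by `(-d)ⁿ = -dⁿ` (`map_eq_smul_of_mem_weilClassesOf`), and `2dⁿ ≠ 0`.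
[cite: vanGeemen1994HodgeAV, 4.9 and Lemma 5.2] [cite: Markman2025SurveySecant, §1.1] -/
theorem eq_zero_of_mem_span_cupPowTwo_of_mem_weilClassesOf (hn : Odd n) (hd : 0 < d) {h : complexBetti A.X 2}
    (hφh : complexBetti.map φ.hom.hom.hom 2 h = (d : ℂ) • h) {v : complexBetti A.X (2 * n)} (hv : v ∈ (ℂ ∙ cupPowTwo h n))
    (hvW : v ∈ weilClassesOf A φ n d) : v = 0 := by
  obtain ⟨a, rfl⟩ := Submodule.mem_span_singleton.1 hv
  have h1 : complexBetti.map φ.hom.hom.hom (2 * n) (a • cupPowTwo h n) = ((d : ℂ) ^ n) • (a • cupPowTwo h n) := by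
    rw [map_smul, map_cupPowTwo_eq_pow_smul_of_map_eq_smul φ hφh n, smul_comm]
  have h2 : complexBetti.map φ.hom.hom.hom (2 * n) (a • cupPowTwo h n) = ((-(d : ℂ)) ^ n) • (a • cupPowTwo h n) :=
    map_eq_smul_of_mem_weilClassesOf hvW
  rw [hn.neg_pow, h1, neg_smul, eq_neg_iff_add_eq_zero, ← two_smul ℂ, smul_smul] at h2
  have hne : (2 : ℂ) * (d : ℂ) ^ n ≠ 0 := mul_ne_zero two_ne_zero (pow_ne_zero _ (Nat.cast_ne_zero.2 hd.ne'))
  exact (smul_eq_zero.1 h2).resolve_left hne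

/-- **`ℂ·hⁿ ⊓ weilClassesOf A φ n d = ⊥`** for `n` odd, `d > 0` and `φ^*h = d·h`: at a compatibly polarised Weil-type anchor the Lefschetz ray of the
polarisation misses the Weil plane. [cite: vanGeemen1994HodgeAV, 4.9, Lemma 5.2 and Thm. 4.11] [cite: Markman2025SurveySecant, §1.1] -/
theorem span_cupPowTwo_inf_weilClassesOf_eq_bot (hn : Odd n) (hd : 0 < d) {h : complexBetti A.X 2}
    (hφh : complexBetti.map φ.hom.hom.hom 2 h = (d : ℂ) • h) : (ℂ ∙ cupPowTwo h n) ⊓ weilClassesOf A φ n d = ⊥ := by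
  rw [Submodule.eq_bot_iff]
  intro v hv
  exact eq_zero_of_mem_span_cupPowTwo_of_mem_weilClassesOf hn hd hφh hv.1 hv.2

/-- **A non-zero class of the Weil plane is off the Lefschetz ray** (`n` odd, `d > 0`, `φ^*h = d·h`). [cite: vanGeemen1994HodgeAV, 4.9 and Lemma 5.2] -/
theorem not_mem_span_cupPowTwo_of_mem_weilClassesOf_of_ne_zero (hn : Odd n) (hd : 0 < d) {h : complexBetti A.X 2}
    (hφh : complexBetti.map φ.hom.hom.hom 2 h = (d : ℂ) • h) {v : complexBetti A.X (2 * n)} (hvW : v ∈ weilClassesOf A φ n d)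
    (hv0 : v ≠ 0) : v ∉ (ℂ ∙ cupPowTwo h n) :=
  fun hv ↦ hv0 (eq_zero_of_mem_span_cupPowTwo_of_mem_weilClassesOf hn hd hφh hv hvW)

end Toolbox

/-! ## §2 At a secant–quotient datum: the off-ray clause is `γ ≠ 0`, and `φ_d^*` fixes every served direction -/

namespace SecantQuotientDatum

variable (D : SecantQuotientDatum)

/-- **`q^*γ` in the Weil plane and `γ ∈ ℂ·h_Y(θ₀)³ ⟹ γ = 0`**: `q^*` maps the ray `ℂ·h_Y(θ₀)³` onto the ray `ℂ·Ξ_d(θ₀)³` of the COMPATIBLE class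
`q^*h_Y(θ₀) = Ξ_d(θ₀)` (R2: `φ_d^*Ξ_d(θ₀) = d·Ξ_d(θ₀)`), which misses the Weil plane of `(J × Ĵ, φ_d)` in degree `6` (§1, `n = 3` odd, `d ≥ 4`), and `q^*`
is injective. [cite: Markman2025SecantWeil, §3.2 Cor. 3.2.3 and §1.5 (p. 7)] [cite: vanGeemen1994HodgeAV, Lemma 5.2 and §3.6] -/
theorem eq_zero_of_mem_span_cupPowTwo_hY_of_map_q_mem_weilClassesOf (θ₀ : complexBetti D.𝒥.J.X 2) {γ : complexBetti D.Y.X (2 * 3)}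
    (hray : γ ∈ (ℂ ∙ cupPowTwo (D.hY θ₀) 3)) (hW : complexBetti.map D.q.hom.hom.hom (2 * 3) γ ∈ weilClassesOf D.P D.ψ 3 D.d) : γ = 0 := by
  have hd : 0 < D.d := lt_of_lt_of_le (by decide) D.four_le
  have hq : complexBetti.map D.q.hom.hom.hom (2 * 3) γ ∈ (ℂ ∙ cupPowTwo (complexBetti.map D.q.hom.hom.hom 2 (D.hY θ₀)) 3) := by
    obtain ⟨a, rfl⟩ := Submodule.mem_span_singleton.1 hray
    rw [map_smul]
    change a • singularCohomology.map ℂ ℂ _ (2 * 3) (cupPowTwo (D.hY θ₀) 3) ∈ _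
    rw [map_cupPowTwo]
    exact Submodule.smul_mem _ _ (Submodule.mem_span_singleton_self _)
  have h0 := eq_zero_of_mem_span_cupPowTwo_of_mem_weilClassesOf (by decide : Odd 3) hd (D.complexBetti_map_ψ_map_q_hY θ₀) hq hW
  exact (D.complexBetti_map_q_bijective (2 * 3)).1 (by rw [h0, map_zero])

/-- **The off-ray clause is `γ ≠ 0`**: a non-zero class `γ` on `Y` with `q^*γ` in the Weil plane of `(J × Ĵ, φ_d)` is NOT on the ray `ℂ·h_Y(θ₀)³`,
for EVERY class `θ₀` (no pin needed). [cite: Markman2025SecantWeil, Thm. 1.4.1 (item 4) and §3.2 Cor. 3.2.3] [cite: vanGeemen1994HodgeAV, Lemma 5.2] -/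
theorem not_mem_span_cupPowTwo_hY_of_ne_zero (θ₀ : complexBetti D.𝒥.J.X 2) {γ : complexBetti D.Y.X (2 * 3)} (hγ0 : γ ≠ 0)
    (hW : complexBetti.map D.q.hom.hom.hom (2 * 3) γ ∈ weilClassesOf D.P D.ψ 3 D.d) : γ ∉ (ℂ ∙ cupPowTwo (D.hY θ₀) 3) :=
  fun hray ↦ hγ0 (D.eq_zero_of_mem_span_cupPowTwo_hY_of_map_q_mem_weilClassesOf θ₀ hray hW)

/-- **`φ_d^*` FIXES EVERY SERVED DIRECTION: `φ_d^*(q^*γ) = -d³·q^*γ`** for `q^*γ` in the Weil plane (both Weil characters take the value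
`(±i√d)⁶ = -d³`). So pulling back along the Weil operator (or its descent `ψ_Y` to `Y`) never produces a SECOND pinned-served direction — the
«`ψ_Y^*` device» reaches only the direction it starts from; (G3) is not class-level transport along `K`. [cite: Markman2025SecantWeil, Thm. 1.4.1 (item 4)]
[cite: Markman2025SurveySecant, §1.1] [cite: vanGeemen1994HodgeAV, 4.9] -/
theorem complexBetti_map_ψ_eq_smul_of_map_q_mem_weilClassesOf {γ : complexBetti D.Y.X (2 * 3)}
    (hW : complexBetti.map D.q.hom.hom.hom (2 * 3) γ ∈ weilClassesOf D.P D.ψ 3 D.d) :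
    complexBetti.map D.ψ.hom.hom.hom (2 * 3) (complexBetti.map D.q.hom.hom.hom (2 * 3) γ) =
      (-((D.d : ℂ) ^ 3)) • complexBetti.map D.q.hom.hom.hom (2 * 3) γ := by
  rw [← Odd.neg_pow (by decide : Odd 3)]
  exact map_eq_smul_of_mem_weilClassesOf hW

/-- Hence the served direction is `φ_d^*`-STABLE: `φ_d^*(q^*γ) ∈ ℂ·q^*γ`. [cite: Markman2025SecantWeil, Thm. 1.4.1 (item 4)] -/
theorem complexBetti_map_ψ_mem_span_of_map_q_mem_weilClassesOf {γ : complexBetti D.Y.X (2 * 3)}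
    (hW : complexBetti.map D.q.hom.hom.hom (2 * 3) γ ∈ weilClassesOf D.P D.ψ 3 D.d) :
    complexBetti.map D.ψ.hom.hom.hom (2 * 3) (complexBetti.map D.q.hom.hom.hom (2 * 3) γ) ∈ (ℂ ∙ complexBetti.map D.q.hom.hom.hom (2 * 3) γ) := by
  rw [D.complexBetti_map_ψ_eq_smul_of_map_q_mem_weilClassesOf hW]
  exact Submodule.smul_mem _ _ (Submodule.mem_span_singleton_self _)

end SecantQuotientDatum

/-! ## §3 The pinned predicate at the identity chart with `γ ≠ 0` in place of the off-ray clause -/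

/-- **INTRODUCTION AT THE IDENTITY CHART FROM `γ ≠ 0`** (the shape (G3) quantifies over): on `D.Y.X` at `θ = h_Y(θ₀)`, a polarisation class `θ₀` of
`Θ`, the polarisation ∕ ample-line ∕ hyperbolicity clauses for `h_Y(θ₀)`, and a NON-ZERO rational class `γ` with `q^*γ` in the Weil plane give a
pinned secant–quotient Weil class — the off-ray clause of `IsSecantQuotientWeilClassAtPinned.of_refl` is discharged by §2.
[cite: Markman2025SecantWeil, §1.5 (p. 7), Thm. 1.4.1 and §3.2 Cor. 3.2.3] [cite: vanGeemen1994HodgeAV, Lemma 5.2] -/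
theorem IsSecantQuotientWeilClassAtPinned.of_refl_of_ne_zero (D : SecantQuotientDatum) {θ₀ : complexBetti D.𝒥.J.X 2}
    (hθ₀ : D.𝒥.J.IsPolarizationClassOf D.Θ θ₀) {γ : complexBetti D.Y.X (2 * 3)} (hpol : IsPolarizationClass 6 D.Y.X (D.hY θ₀))
    (hamp : ∃ H : CartierDivisor D.Y.X.left, H.IsAmple ∧ D.Y.IsPolarizationClassOf H (D.hY θ₀))
    (hhyp : IsHyperbolicWeilType D.P D.ψ 3 (complexBetti.map D.q.hom.hom.hom 2 (D.hY θ₀)))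
    (hγ : IsRationalClass γ) (hγ0 : γ ≠ 0) (hmem : complexBetti.map D.q.hom.hom.hom (2 * 3) γ ∈ weilClassesOf D.P D.ψ 3 D.d) :
    IsSecantQuotientWeilClassAtPinned D.Y.X (D.hY θ₀) γ :=
  IsSecantQuotientWeilClassAtPinned.of_refl D hθ₀ hpol hamp hhyp hγ (D.not_mem_span_cupPowTwo_hY_of_ne_zero θ₀ hγ0 hmem) hmem

/-- **Conversely every pinned-served class is non-zero** (it is off the ray `ℂ·θ³ ∋ 0`). [cite: Markman2025SecantWeil, Thm. 1.4.1 (item 4)] -/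
theorem IsSecantQuotientWeilClassAtPinned.ne_zero {X : SchemeOver ℂ} {θ : complexBetti X 2} {γ : complexBetti X (2 * 3)}
    (h : IsSecantQuotientWeilClassAtPinned X θ γ) : γ ≠ 0 :=
  fun h0 ↦ h.not_mem_span (h0 ▸ Submodule.zero_mem _)

/-- **At the identity chart of a datum with the anchor clauses for `h_Y(θ₀)`, the pinned-served set CONTAINS every non-zero rational class whose
pull-back lies in the Weil plane** — (G3)'s domain at that anchor is (at least) the punctured rational Weil plane, a `P¹(ℚ)`-worth of directions.
[cite: Markman2025SecantWeil, Thm. 1.4.1 (item 4) and §1.5] [cite: vanGeemen1994HodgeAV, 4.9 and Lemma 5.2] -/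
theorem SecantQuotientDatum.setOf_ne_zero_rational_weil_subset_servedClassesPinned (D : SecantQuotientDatum) {θ₀ : complexBetti D.𝒥.J.X 2}
    (hθ₀ : D.𝒥.J.IsPolarizationClassOf D.Θ θ₀) (hpol : IsPolarizationClass 6 D.Y.X (D.hY θ₀))
    (hamp : ∃ H : CartierDivisor D.Y.X.left, H.IsAmple ∧ D.Y.IsPolarizationClassOf H (D.hY θ₀))
    (hhyp : IsHyperbolicWeilType D.P D.ψ 3 (complexBetti.map D.q.hom.hom.hom 2 (D.hY θ₀))) :
    {γ : complexBetti D.Y.X (2 * 3) | γ ≠ 0 ∧ IsRationalClass γ ∧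
        complexBetti.map D.q.hom.hom.hom (2 * 3) γ ∈ weilClassesOf D.P D.ψ 3 D.d} ⊆
      secantQuotientServedClassesPinned D.Y.X (D.hY θ₀) :=
  fun _ h ↦ IsSecantQuotientWeilClassAtPinned.of_refl_of_ne_zero D hθ₀ hpol hamp hhyp h.2.1 h.1 h.2.2

/-- **Modulo print's pinned claim L1″ (any door), the level-`d` pinned anchor it supplies has this shape**: for every even `d ≥ 4` there are `D`, `θ₀`
with `D.d = d` at which EVERY non-zero rational class pulling back into the Weil plane is pinned-served — the `P¹(ℚ)` of directions that stub 2a‴ asks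
to carry at print's own anchor, of which print carries ONE. [cite: Markman2025SecantWeil, Thm. 1.4.1 (item 4) and §1.5] [cite: vanGeemen1994HodgeAV, 4.9] -/
theorem exists_datum_setOf_ne_zero_rational_weil_subset_servedClassesPinned_of_pinned {C : ChernCharacterBetti} {Adm : PerfectAdmissibility}
    (hM : Markman2025_secantQuotient_twistedCarrier_onJacobian_pinned C Adm) {d : ℕ} (hd : Even d) (h4 : 4 ≤ d) :
    ∃ (D : SecantQuotientDatum) (θ₀ : complexBetti D.𝒥.J.X 2), D.d = d ∧ D.𝒥.J.IsPolarizationClassOf D.Θ θ₀ ∧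
      secantQuotientAnchorsPinned D.Y.X (D.hY θ₀) ∧
      {γ : complexBetti D.Y.X (2 * 3) | γ ≠ 0 ∧ IsRationalClass γ ∧
          complexBetti.map D.q.hom.hom.hom (2 * 3) γ ∈ weilClassesOf D.P D.ψ 3 D.d} ⊆
        secantQuotientServedClassesPinned D.Y.X (D.hY θ₀) := by
  obtain ⟨D, θ₀, γ, hDd, hθ₀, -, -, -, -, -, hpol, hamp, hhyp, -, -, -, -, -, -, hW, -⟩ :=
    exists_secantQuotientDatum_compatibleClauses_of_pinned hM hd h4
  exact ⟨D, θ₀, hDd, hθ₀, ⟨γ, hW⟩, D.setOf_ne_zero_rational_weil_subset_servedClassesPinned hθ₀ hpol hamp hhyp⟩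

end Summit.HodgeConjecture.HodgeConjecture.Ring2.SemiregularRepresentatives

end
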